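/-
Copyright (c) 2026. All rights reserved.
Released under Apache 2.0 license as described in the file LICENSE.
-/
import Literature.AlgebraicGeometry.Pohlmann1968.DegenerateCMTypesMultiquadraticCMFieldParity
import HarnessLib

/-!
# Multiquadratic CM fields: the NUMBER of imaginary quadratic subfields (`[K:ℚ]/2`) and the number of them over
# which a CM type is of Weil type — degree `8`: none or exactly three of the four; degree `16`: `0`, `4` or `7` of
# the eight

The tree's `DegenerateCMTypesMultiquadraticCMField` (seat p10 g37-#2) proves, for a multiquadratic CM field `K`
(`K/ℚ` Galois, `g² = 1` for `g ∈ Gal(K/ℚ)`) and any CM type `Φ`, the exact formula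
`Rank(Φ) + #W(Φ) = [K:ℚ]/2 + 1`, `W(Φ)` = the imaginary quadratic subfields `F ⊆ K` over which `Φ` is of Weil type
(balanced), and `DegenerateCMTypesMultiquadraticCMFieldParity` (g37-#4) the rank spectra `{5, 2}` (`[K:ℚ] = 8`) and
`{9, 5, 2}` (`[K:ℚ] = 16`) (T. Kubota [Kubota1965] §4 Lemma 2; B. Dodson [Dodson1984] §3.1.1, §3.3.2).  THIS FILE
counts the subfields:

* §1 **`two_mul_card_indexTwo_not_mem_eq`** (group level, exponent `2`): an elementary abelian `2`-group `G` with
  `ρ ≠ 1` has exactly `|G|/2` subgroups of index `2` NOT containing `ρ` (they are the kernels of the `|G|/2` odd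
  characters, tree `two_mul_ncard_oddCharacters_eq_card`); **`two_mul_ncard_imaginaryQuadratic_eq`** — a
  multiquadratic CM field `K` has EXACTLY `[K:ℚ]/2` imaginary quadratic subfields (`K = ℚ(√−d, √a₁, …, √a_r)`:
  the `2^r` fields `ℚ(√(−d·∏_{i∈I} aᵢ))`).
* §2 **`ncard_weilQuadratic_eq_zero_or_three_of_finrank_eq_eight`** — a CM type of a TRIQUADRATIC CM field is of Weil
  type over NONE (the `8` nondegenerate, primitive types) or over EXACTLY THREE of its FOUR imaginary quadratic
  subfields (the `8` induced types of rank `2`; `ncard_imaginaryQuadratic_eq_four_of_finrank_eq_eight`);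
  **`ncard_weilQuadratic_mem_of_finrank_eq_sixteen`** — degree `16`: over `0`, `4` or `7` of its `8` imaginary
  quadratic subfields.
* §3 `cyclotomic_twentyFour_weilCount` (`ℚ(ζ₂₄)`: four imaginary quadratic subfields `ℚ(i)`, `ℚ(√−2)`, `ℚ(√−3)`,
  `ℚ(√−6)`; every CM type is of Weil type over none or exactly three of them).

HONEST SCOPE.  Corollaries of the two neighbouring files and the Galois correspondence; the subfield count is
textbook (index-`2` subgroups of `(ℤ/2)^{r+1}` missing a given element), cited to Kubota's character count from which
it is derived here.  THEOREMS ONLY: no definition, no named fact, no instance, no `sorry`.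

## References

* [Kubota1965] T. Kubota, Trans. AMS 118 (1965), §4 Lemma 2 and its proof ("let `ψ₁, …, ψ_m` be all characters of
  `G` which take `−1` at `ρ`", `|G| = 2m`) (held text, p. 119).
* [Dodson1984] B. Dodson, Trans. AMS 283 (1984), §3.1.1 Theorem, §3.3.2 Theorem.
* [MilneFT2022] J. S. Milne, *Fields and Galois Theory*, Thm. 3.16 (Galois correspondence).
* [Shimura1998] G. Shimura, *Abelian Varieties with Complex Multiplication and Modular Functions*, §8.4 Example (2)(A).

## Provenance

Lane `lit-hodgefound` (Track 2, Layer A4), seat `lit-hodgefound-p10` generation 37, row g37-#7; neighbours cited by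
name, nothing restated: `DegenerateCMTypesMultiquadraticCMField` (`cmTypeRank_add_ncard_weilQuadratic_eq`,
`cyclotomic_twentyFour`), `DegenerateCMTypesMultiquadraticCMFieldParity` (`cmTypeRank_eq_five_or_two_of_finrank_eq_eight`,
`cmTypeRank_mem_of_finrank_eq_sixteen`), `DegenerateCMTypesElementaryAbelianTwoGroup`
(`ExponentTwo.two_mul_card_filter_univ_eq`), `DegenerateCMTypesAbelianKernels` (`exists_oddChar_ker`),
`CMTypeRankCharactersNumberField` (`two_mul_ncard_oddCharacters_eq_card`), `DegenerateCMTypesAbelianCMFieldCyclicSubfields`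
(`conjGal_not_mem_iff_not_isTotallyReal_fixedField`, `index_eq_finrank_fixedField`), `CosetGermGaloisSetting`.
-/

open scoped BigOperators NumberField IsMulCommutative Classical
open NumberField IntermediateField

namespace Literature.AlgebraicGeometry.Pohlmann1968

namespace Multiquadratic

open Literature.NumberTheory.ComplexMultiplication
open Literature.NumberTheory.ComplexMultiplication.CMNumbers
open Literature.AlgebraicGeometry.Motives (CMType)
open Literature.AlgebraicGeometry.Pohlmann1968.AbelianKernels

/-! ## §1 Counting the index-`2` subgroups missing `ρ` / the imaginary quadratic subfields -/

section Group

variable {G : Type*} [CommGroup G] [Fintype G]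

omit [Fintype G] in
/-- `χ(gh) = χ(g)χ(h)`. [folklore] -/
private theorem char_mul' (χ : AddChar (Additive G) ℂ) (g h : G) :
    χ (Additive.ofMul (g * h)) = χ (Additive.ofMul g) * χ (Additive.ofMul h) := by
  rw [ofMul_mul, AddChar.map_add_eq_mul]

/-- **An elementary abelian `2`-group has exactly `|G|/2` index-`2` subgroups missing a given `ρ ≠ 1`** — they are
the kernels of the `|G|/2` odd characters (`χ(ρ) = −1`), a `±1`-valued character being determined by its kernel.
[cite: Kubota1965, §4 Lemma 2 (proof)] -/
theorem two_mul_card_indexTwo_not_mem_eq (hexp : ∀ g : G, g ^ 2 = 1) {ρ : G} (hρ1 : ρ ≠ 1) :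
    2 * ((Finset.univ : Finset (Subgroup G)).filter fun H : Subgroup G => ρ ∉ H ∧ H.index = 2).card =
      Fintype.card G := by
  have hρ2 : ρ * ρ = 1 := by rw [← pow_two]; exact hexp ρ
  have hval : ∀ (χ : AddChar (Additive G) ℂ) (g : G), χ (Additive.ofMul g) = 1 ∨ χ (Additive.ofMul g) = -1 :=
    fun χ g => character_apply_eq_one_or_of_mul_self χ (by rw [← pow_two]; exact hexp g)
  -- the kernel of a character, as a subgroup
  let κ : AddChar (Additive G) ℂ → Subgroup G := fun χ =>
    MonoidHom.ker
      { toFun := fun g => χ (Additive.ofMul g)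
        map_one' := by rw [ofMul_one, AddChar.map_zero_eq_one]
        map_mul' := fun a b => char_mul' χ a b }
  have hκ : ∀ (χ : AddChar (Additive G) ℂ) (g : G), g ∈ κ χ ↔ χ (Additive.ofMul g) = 1 := fun χ g => by
    rw [MonoidHom.mem_ker]; rfl
  set O := Finset.univ.filter (fun χ : AddChar (Additive G) ℂ => χ (Additive.ofMul ρ) = -1) with hO
  set B := (Finset.univ : Finset (Subgroup G)).filter (fun H : Subgroup G => ρ ∉ H ∧ H.index = 2) with hB
  -- `κ` maps `O` onto `B`, injectively
  have hindex : ∀ χ ∈ O, (κ χ).index = 2 := by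
    intro χ hχ
    have hχρ : χ (Additive.ofMul ρ) = -1 := (Finset.mem_filter.1 hχ).2
    have hχ0 : χ ≠ 0 := fun h0 => by rw [h0, AddChar.zero_apply] at hχρ; norm_num at hχρ
    have hHc : ((κ χ : Subgroup G) : Set G) =
        ↑(Finset.univ.filter fun g : G => ¬ χ (Additive.ofMul g) = -1) := by
      ext g
      simp only [SetLike.mem_coe, hκ, Finset.coe_filter, Finset.mem_univ, true_and, Set.mem_setOf_eq]
      constructor
      · intro h1; rw [h1]; norm_num
      · intro h1; exact (hval χ g).resolve_right h1
    have hcard : 2 * ((κ χ : Subgroup G) : Set G).ncard = Fintype.card G := by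
      rw [hHc, Set.ncard_coe_finset]
      have h1 := CyclicCMType.ExponentTwo.two_mul_card_filter_univ_eq hexp hχ0
      have h2 := Finset.card_filter_add_card_filter_not (s := (Finset.univ : Finset G))
        (fun g : G => χ (Additive.ofMul g) = -1)
      rw [Finset.card_univ] at h2
      omega
    have h1 := (κ χ).index_mul_card
    have h2 : Nat.card (κ χ) = ((κ χ : Subgroup G) : Set G).ncard := Nat.card_coe_set_eq _
    rw [h2, Nat.card_eq_fintype_card, ← hcard] at h1
    have hpos : 0 < ((κ χ : Subgroup G) : Set G).ncard := by
      rw [Set.ncard_pos (Set.toFinite _)]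
      exact ⟨1, (κ χ).one_mem⟩
    exact Nat.eq_of_mul_eq_mul_right hpos h1
  have himage : B = O.image κ := by
    ext H
    rw [hB, Finset.mem_filter, Finset.mem_image]
    simp only [Finset.mem_univ, true_and]
    constructor
    · rintro ⟨hρH, hidx⟩
      haveI : Fact (Nat.Prime 2) := ⟨Nat.prime_two⟩
      have hcyc : IsCyclic (G ⧸ H) := isCyclic_of_prime_card (p := 2) (by rw [← Subgroup.index_eq_card, hidx])
      obtain ⟨χ, hχρ, hker⟩ := CyclicCMType.AbelianKernels.exists_oddChar_ker hρH hρ2 hcyc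
      refine ⟨χ, by rw [hO, Finset.mem_filter]; exact ⟨Finset.mem_univ _, hχρ⟩, ?_⟩
      ext g
      rw [hκ, hker]
    · rintro ⟨χ, hχ, rfl⟩
      have hχρ : χ (Additive.ofMul ρ) = -1 := (Finset.mem_filter.1 hχ).2
      refine ⟨fun h => ?_, hindex χ hχ⟩
      rw [hκ, hχρ] at h
      norm_num at h
  have hinj : Set.InjOn κ ↑O := by
    intro χ _ χ' _ hχχ'
    ext a
    have h := SetLike.ext_iff.1 hχχ' (Additive.toMul a)
    rw [hκ, hκ] at h
    change χ (Additive.ofMul (Additive.toMul a)) = χ' (Additive.ofMul (Additive.toMul a))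
    rcases hval χ (Additive.toMul a) with h1 | h1 <;> rcases hval χ' (Additive.toMul a) with h2 | h2
    · rw [h1, h2]
    · exact absurd (h.1 h1) (by rw [h2]; norm_num)
    · exact absurd (h.2 h2) (by rw [h1]; norm_num)
    · rw [h1, h2]
  rw [himage, Finset.card_image_of_injOn hinj]
  have hOset : {χ : AddChar (Additive G) ℂ | χ (Additive.ofMul ρ) = -1} = ↑O := by
    ext χ; simp [hO]
  have := two_mul_ncard_oddCharacters_eq_card hρ1 hρ2
  rwa [hOset, Set.ncard_coe_finset] at this

end Group

section Field

variable {K : Type} [Field K] [NumberField K] [IsCMField K] [IsGalois ℚ K]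

/-- A group of exponent `2` is commutative. [folklore] -/
private theorem mul_comm_of_sq_eq_one'' {G : Type*} [Group G] (hexp : ∀ g : G, g ^ 2 = 1) (a b : G) :
    a * b = b * a := by
  have hinv : ∀ x : G, x⁻¹ = x := fun x => inv_eq_of_mul_eq_one_right (by rw [← pow_two]; exact hexp x)
  calc a * b = (a * b)⁻¹ := (hinv _).symm
    _ = b⁻¹ * a⁻¹ := mul_inv_rev a b
    _ = b * a := by rw [hinv, hinv]

omit [IsCMField K] in
/-- A Galois extension whose Galois group has exponent `2` is abelian. [folklore] -/
private theorem isAbelianGalois_of_sq_eq_one'' (hexp : ∀ g : K ≃ₐ[ℚ] K, g ^ 2 = 1) : IsAbelianGalois ℚ K :=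
  { is_comm.comm := mul_comm_of_sq_eq_one'' hexp }

omit [IsGalois ℚ K] in
/-- Complex conjugation is a non-trivial element of `Gal(K/ℚ)` for a CM field `K`. [folklore] -/
private theorem conjGal_ne_one₂ : (conjGal : K ≃ₐ[ℚ] K) ≠ 1 := by
  intro h
  apply IsCMField.complexConj_ne_one K
  refine AlgEquiv.ext fun x => ?_
  have := AlgEquiv.congr_fun h x
  rw [conjGal_apply, AlgEquiv.one_apply] at this
  rw [this, AlgEquiv.one_apply]

/-- **A MULTIQUADRATIC CM FIELD HAS EXACTLY `[K:ℚ]/2` IMAGINARY QUADRATIC SUBFIELDS** (and so `[K:ℚ]/2 − 1` real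
quadratic ones): `2·#{F ⊆ K : [F:ℚ] = 2, F not totally real} = [K:ℚ]` — the index-`2` subgroups of `Gal(K/ℚ)`
missing the complex conjugation, under `H ↦ K^H`. [cite: Kubota1965, §4 Lemma 2 (proof)] [cite: MilneFT2022, Thm. 3.16] -/
theorem two_mul_ncard_imaginaryQuadratic_eq (hexp : ∀ g : K ≃ₐ[ℚ] K, g ^ 2 = 1) :
    2 * {F : IntermediateField ℚ K | Module.finrank ℚ F = 2 ∧ ¬ IsTotallyReal F}.ncard = Module.finrank ℚ K := by
  haveI := isAbelianGalois_of_sq_eq_one'' hexp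
  obtain ⟨φ₀⟩ := (inferInstance : Nonempty (K →+* ℂ))
  set B := (Finset.univ : Finset (Subgroup (K ≃ₐ[ℚ] K))).filter
    (fun H : Subgroup (K ≃ₐ[ℚ] K) => (conjGal : K ≃ₐ[ℚ] K) ∉ H ∧ H.index = 2) with hB
  have hinj : Function.Injective (fun H : Subgroup (K ≃ₐ[ℚ] K) => fixedField H) := fun H H' hHH' => by
    have := congrArg IntermediateField.fixingSubgroup hHH'
    simpa only [fixingSubgroup_fixedField] using this
  have himage : (fun H : Subgroup (K ≃ₐ[ℚ] K) => fixedField H) '' (↑B : Set (Subgroup (K ≃ₐ[ℚ] K))) =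
      {F : IntermediateField ℚ K | Module.finrank ℚ F = 2 ∧ ¬ IsTotallyReal F} := by
    ext F
    simp only [Set.mem_image, Finset.mem_coe, hB, Finset.mem_filter, Finset.mem_univ, true_and,
      Set.mem_setOf_eq]
    constructor
    · rintro ⟨H, ⟨hρH, hidx⟩, rfl⟩
      exact ⟨by rw [← index_eq_finrank_fixedField, hidx], (conjGal_not_mem_iff_not_isTotallyReal_fixedField H).1 hρH⟩
    · rintro ⟨h2, hF⟩
      exact ⟨F.fixingSubgroup, ⟨(conjGal_not_mem_fixingSubgroup_iff F).2 hF, index_fixingSubgroup_eq_two F h2⟩,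
        IsGalois.fixedField_fixingSubgroup F⟩
  rw [← himage, Set.ncard_image_of_injective _ hinj, Set.ncard_coe_finset, hB,
    two_mul_card_indexTwo_not_mem_eq hexp conjGal_ne_one₂, card_gal_eq_finrank φ₀]

/-- **Degree `8`: FOUR imaginary quadratic subfields.** [cite: Kubota1965, §4 Lemma 2 (proof)] [cite: MilneFT2022, Thm. 3.16] -/
theorem ncard_imaginaryQuadratic_eq_four_of_finrank_eq_eight (hexp : ∀ g : K ≃ₐ[ℚ] K, g ^ 2 = 1)
    (h8 : Module.finrank ℚ K = 8) :
    {F : IntermediateField ℚ K | Module.finrank ℚ F = 2 ∧ ¬ IsTotallyReal F}.ncard = 4 := by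
  have := two_mul_ncard_imaginaryQuadratic_eq hexp
  omega

/-! ## §2 Over how many imaginary quadratic subfields is a CM type of Weil type? -/

/-- **A CM TYPE OF A TRIQUADRATIC CM FIELD IS OF WEIL TYPE OVER NONE OR EXACTLY THREE OF ITS FOUR IMAGINARY QUADRATIC
SUBFIELDS** (`[K:ℚ] = 8`: `Rank(Φ) + #W(Φ) = 5` and `Rank(Φ) ∈ {5, 2}`). [cite: Kubota1965, §4 Lemma 2]
[cite: Dodson1984, §3.1.1 Theorem] [cite: Dodson1984, §3.3.2 Theorem] -/
theorem ncard_weilQuadratic_eq_zero_or_three_of_finrank_eq_eight (hexp : ∀ g : K ≃ₐ[ℚ] K, g ^ 2 = 1)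
    (h8 : Module.finrank ℚ K = 8) (Φ : CMType K) :
    {F : IntermediateField ℚ K | Module.finrank ℚ F = 2 ∧ ¬ IsTotallyReal F ∧
        ∀ τ : F →+* ℂ, {φ : K →+* ℂ | φ.comp (algebraMap F K) = τ ∧ φ ∈ Φ.1}.ncard =
          {φ : K →+* ℂ | φ.comp (algebraMap F K) = τ ∧ φ ∉ Φ.1}.ncard}.ncard = 0 ∨
      {F : IntermediateField ℚ K | Module.finrank ℚ F = 2 ∧ ¬ IsTotallyReal F ∧
        ∀ τ : F →+* ℂ, {φ : K →+* ℂ | φ.comp (algebraMap F K) = τ ∧ φ ∈ Φ.1}.ncard =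
          {φ : K →+* ℂ | φ.comp (algebraMap F K) = τ ∧ φ ∉ Φ.1}.ncard}.ncard = 3 := by
  have key := cmTypeRank_add_ncard_weilQuadratic_eq hexp Φ
  have hr := cmTypeRank_eq_five_or_two_of_finrank_eq_eight hexp h8 Φ
  rw [h8] at key
  omega

/-- **Degree `8`: nondegenerate ⟺ of Weil type over NO imaginary quadratic subfield ⟺ not over three.**
[cite: Kubota1965, §4 Lemma 2] [cite: Dodson1984, §3.1.1 Theorem] -/
theorem isNondegenerate_iff_ncard_weilQuadratic_eq_zero_of_finrank_eq_eight (hexp : ∀ g : K ≃ₐ[ℚ] K, g ^ 2 = 1)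
    (h8 : Module.finrank ℚ K = 8) (Φ : CMType K) :
    IsNondegenerate Φ ↔ {F : IntermediateField ℚ K | Module.finrank ℚ F = 2 ∧ ¬ IsTotallyReal F ∧
        ∀ τ : F →+* ℂ, {φ : K →+* ℂ | φ.comp (algebraMap F K) = τ ∧ φ ∈ Φ.1}.ncard =
          {φ : K →+* ℂ | φ.comp (algebraMap F K) = τ ∧ φ ∉ Φ.1}.ncard}.ncard = 0 := by
  have key := cmTypeRank_add_ncard_weilQuadratic_eq hexp Φ
  rw [_root_.Literature.AlgebraicGeometry.Pohlmann1968.isNondegenerate_iff, h8] at *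
  omega

/-- **A CM TYPE OF A MULTIQUADRATIC CM FIELD OF DEGREE `16` IS OF WEIL TYPE OVER `0`, `4` OR `7` OF ITS EIGHT
IMAGINARY QUADRATIC SUBFIELDS** (`Rank(Φ) + #W(Φ) = 9`, `Rank(Φ) ∈ {9, 5, 2}`). [cite: Kubota1965, §4 Lemma 2]
[cite: Dodson1984, §3.1.1 Theorem] -/
theorem ncard_weilQuadratic_mem_of_finrank_eq_sixteen (hexp : ∀ g : K ≃ₐ[ℚ] K, g ^ 2 = 1)
    (h16 : Module.finrank ℚ K = 16) (Φ : CMType K) :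
    {F : IntermediateField ℚ K | Module.finrank ℚ F = 2 ∧ ¬ IsTotallyReal F ∧
        ∀ τ : F →+* ℂ, {φ : K →+* ℂ | φ.comp (algebraMap F K) = τ ∧ φ ∈ Φ.1}.ncard =
          {φ : K →+* ℂ | φ.comp (algebraMap F K) = τ ∧ φ ∉ Φ.1}.ncard}.ncard = 0 ∨
      {F : IntermediateField ℚ K | Module.finrank ℚ F = 2 ∧ ¬ IsTotallyReal F ∧
        ∀ τ : F →+* ℂ, {φ : K →+* ℂ | φ.comp (algebraMap F K) = τ ∧ φ ∈ Φ.1}.ncard =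
          {φ : K →+* ℂ | φ.comp (algebraMap F K) = τ ∧ φ ∉ Φ.1}.ncard}.ncard = 4 ∨
      {F : IntermediateField ℚ K | Module.finrank ℚ F = 2 ∧ ¬ IsTotallyReal F ∧
        ∀ τ : F →+* ℂ, {φ : K →+* ℂ | φ.comp (algebraMap F K) = τ ∧ φ ∈ Φ.1}.ncard =
          {φ : K →+* ℂ | φ.comp (algebraMap F K) = τ ∧ φ ∉ Φ.1}.ncard}.ncard = 7 := by
  have key := cmTypeRank_add_ncard_weilQuadratic_eq hexp Φ
  have hr := cmTypeRank_mem_of_finrank_eq_sixteen hexp h16 Φ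
  rw [h16] at key
  omega

/-- **Degree `16`: eight imaginary quadratic subfields.** [cite: Kubota1965, §4 Lemma 2 (proof)] [cite: MilneFT2022, Thm. 3.16] -/
theorem ncard_imaginaryQuadratic_eq_eight_of_finrank_eq_sixteen (hexp : ∀ g : K ≃ₐ[ℚ] K, g ^ 2 = 1)
    (h16 : Module.finrank ℚ K = 16) :
    {F : IntermediateField ℚ K | Module.finrank ℚ F = 2 ∧ ¬ IsTotallyReal F}.ncard = 8 := by
  have := two_mul_ncard_imaginaryQuadratic_eq hexp
  omega

end Field

/-! ## §3 `ℚ(ζ₂₄)` -/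

section Cyclotomic

variable {K : Type} [Field K] [NumberField K]

/-- `Gal(ℚ(ζₙ)/ℚ) ≅ (ℤ/n)ˣ`: exponent `2` from `u² = 1` for all units. [folklore] -/
private theorem gal_sq_eq_one'' {n : ℕ} [NeZero n] [IsCyclotomicExtension {n} ℚ K]
    (h : ∀ u : (ZMod n)ˣ, u ^ 2 = 1) (g : K ≃ₐ[ℚ] K) : g ^ 2 = 1 :=
  (IsCyclotomicExtension.Rat.galEquivZMod n K).injective (by rw [map_pow, map_one, h])

/-- **`ℚ(ζ₂₄)`: four imaginary quadratic subfields (`ℚ(i)`, `ℚ(√−2)`, `ℚ(√−3)`, `ℚ(√−6)`), and every CM type is of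
Weil type over NONE of them (rank `5`) or over EXACTLY THREE of them (rank `2`).** [cite: Kubota1965, §4 Lemma 2]
[cite: Dodson1984, §3.3.2 Theorem] -/
theorem cyclotomic_twentyFour_weilCount [IsCyclotomicExtension {24} ℚ K] (Φ : CMType K) :
    {F : IntermediateField ℚ K | Module.finrank ℚ F = 2 ∧ ¬ IsTotallyReal F}.ncard = 4 ∧
      ({F : IntermediateField ℚ K | Module.finrank ℚ F = 2 ∧ ¬ IsTotallyReal F ∧
          ∀ τ : F →+* ℂ, {φ : K →+* ℂ | φ.comp (algebraMap F K) = τ ∧ φ ∈ Φ.1}.ncard =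
            {φ : K →+* ℂ | φ.comp (algebraMap F K) = τ ∧ φ ∉ Φ.1}.ncard}.ncard = 0 ∨
        {F : IntermediateField ℚ K | Module.finrank ℚ F = 2 ∧ ¬ IsTotallyReal F ∧
          ∀ τ : F →+* ℂ, {φ : K →+* ℂ | φ.comp (algebraMap F K) = τ ∧ φ ∈ Φ.1}.ncard =
            {φ : K →+* ℂ | φ.comp (algebraMap F K) = τ ∧ φ ∉ Φ.1}.ncard}.ncard = 3) := by
  haveI := IsCyclotomicExtension.isGalois {24} ℚ K
  haveI := IsCyclotomicExtension.Rat.isCMField K (S := {24}) ⟨24, rfl, by norm_num⟩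
  have hexp : ∀ g : K ≃ₐ[ℚ] K, g ^ 2 = 1 := gal_sq_eq_one'' (n := 24) (by decide)
  have h8 : Module.finrank ℚ K = 8 := by
    rw [IsCyclotomicExtension.finrank K (Polynomial.cyclotomic.irreducible_rat (show 0 < 24 by norm_num))]
    decide
  exact ⟨ncard_imaginaryQuadratic_eq_four_of_finrank_eq_eight hexp h8,
    ncard_weilQuadratic_eq_zero_or_three_of_finrank_eq_eight hexp h8 Φ⟩

end Cyclotomic

end Multiquadratic

end Literature.AlgebraicGeometry.Pohlmann1968
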